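import Summits.QuantumFields.YangMills.Theorems.BalabanUVNodesN17RunRemAtOfShiftAnchor

/-!
# NODE N17 (NE4) — SUPPLIER ROAD TO K2⁷'s REGISTERED 2ᴮ″, FILE 2: survivor continuity is ANTITONE in the level, so node N17's junction needs (C) at ONE positive level
# only; hence, GIVEN N17, the registered run letter `RunRemAt F κ θ hP θ.cβ` ⟺ «κ anchors ∧ (C) at some level», and the 2ᴮ″ TEXT ⟺ the text «∃ κ, anchor ∧ ∃ γ₀ > 0, SurvCont»

Cell `pub-ymgap`, YM-PLAN Track A (HUMAN RULINGS D-0062 ∕ D-0149), WIDTH SEAT `pub-ymgap-dag-n17-w1` (generation 3), second module.  Key K3⁷ stmt-QuantumFields-20544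
(`--kind proof --supports 20544 --as helper`, COUNT-NEUTRAL); via node N17 also K2⁷ stmt-QuantumFields-20543 (skeleton v6 5a75a2378c79b303: 1ᴬ `stub_d1AnchoredJets13`, 2ᴮ″
`stub_runRemNamedJets13 : RunRemAtSomeJets`).  Continues FILE 1 `Theorems/BalabanUVNodesN17RunRemAtOfShiftAnchor` (p600401): there the junction «N17 + `ScaleAnchor` + `SurvCont`
at EVERY level `≤ θ.γ` ⟹ `RunRemAt`» asked survivor continuity at all small levels, because the lever's box `γ_s` is not known in advance.  THIS FILE removes the over-ask:
DEF-1's survivor-continuity letter is ANTITONE IN THE LEVEL (★ `survCont_anti`: for `0 < γ' ≤ γ`, a survivor of level `γ'` is a survivor of level `γ` with the SAME clamped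
prefix — DEF-1's `run_of_survivor` + pub-balaban-gaps' `EndRunwiseShooting.Y_eq_of_run` ∕ `survives_of_run` ∕ `shoot_zero` BY NAME — so the traces of level `γ'` are restrictions
of the traces of level `γ`), hence (C) at ANY ONE positive level `γ₀` feeds the junction at `min γ_s γ₀` (★★ `runRemAt_of_n17At_scaleAnchor_survContAt`).  CONSEQUENCE
(★★★ `runRemAt_iff_anchor_survCont_of_n17At`): GIVEN node N17 at the tuple (`N17At (datumOfRecord₁₃SepCoPH F 2 θ hP) u`, `u.γ = θ.γ`, `0 ≤ u.ρ < 1`),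
  `RunRemAt F κ θ hP θ.cβ  ⟺  ScaleAnchor D.βfun (θ.cβ • beta0OfJs F κ) ∧ ∃ γ₀ > 0, SurvCont D.βfun γ₀`
— the registered letter's quantitative (D4)∧B4 conjunct (`RunConstRemainder` under the cap `s ≤ θ.cβ·stepBal 2 F.L`) and its window clause `γ₀ ≤ θ.γ` carry NO content beyond
N17 + 2ᴮ″'s own two qualitative conjuncts; at text level (K2⁷ v6's full prefix, `Window13` spelled as the crux decl spells it) ★★★
`runRemAtSomeJets_iff_anchorSurvAtSomeJets_of_n17AtRecord13`: GIVEN the `N17AtRecord13` text, the REGISTERED 2ᴮ″ text ⟺ «∃ κ, ScaleAnchor … ∧ ∃ γ₀ > 0, SurvCont … γ₀»; and the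
crux decl BY NAME from {1ᴬ's text, N17's text, that text} (`EndpointGivenBR13SepCoPH_of_d1Anchored_n17_anchorSurvAt`, through DEF-1's `endpointExistence_of_runRemAt_drift`).
So, modulo node N17 (the END-free text `N17AtRecord13`), K2⁷'s XL stub 2ᴮ″ is EXACTLY «some colour datum's scaled named numbers are the per-scale zero-history limits of the record's β» (the
identification, [Balaban1987RG1] (2.13) p. 268 read per scale at the named numbers) ∧ «survivor continuity at one level» ([I] §1 pp. 263–264, asserted without proof).

WHAT THIS FILE PROVES (theorems only; 0 `def`, 0 `instance`, 0 `sorry`): §1 `survivor_mono_level`, ★ `survCont_anti`, `runLetters_mono`; §2 (N = 2, `datumOfRecord₁₃SepCoPH`)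
★★ `runRemAt_of_n17At_scaleAnchor_survContAt`, ★★★ `runRemAt_iff_anchor_survCont_of_n17At`; §3 (texts inline) ★★★ `runRemAtSomeJets_iff_anchorSurvAtSomeJets_of_n17AtRecord13`,
`EndpointGivenBR13SepCoPH_of_d1Anchored_n17_anchorSurvAt`.  LOCATED (K3⁷ v4 17c74fac127b5f61, plan g82 l.27703): v4 keys `KeyedRatesHolderD4` on the FULL prefix
INCLUDING `DagBinding.EndpointExistence (datumOfRecord₁₃CoPH F 2 θ hP).C.toB12` and `ForSmallCouplings`, so K3⁷'s stub 1 can NO LONGER supply K2⁷'s N17 (its N17 conjunct now holds GIVEN the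
endpoint K2⁷ is to produce — a bridge «stub_rates13H ⟹ 2ᴮ″» would be circular); the junction's N17 input for K2⁷ is therefore the END-FREE text `N17AtRecord13` (K2⁷ v6 annex; the n17∕n18
lanes' N17-at-the-record roads `…N17AtU3OfKernels`, `…N18KernelStepRateBoxes` are END-free), and dag-n17-w1 g2's v3-shape bridge `n17AtRecord13Guarded_of_stub_rates13H_shape` (p594044) is
not re-keyed here.  DEF-1's `RunRemAt` ∕ `RunConstRemainder` ∕ `SurvCont` ∕ `Survivors` ∕ `ScaleAnchor` ∕ `run_of_survivor` ∕
`endpointExistence_of_runRemAt_drift`, Gaps' `shoot_zero` ∕ `Y_eq_of_run` ∕ `survives_of_run`, FILE 1's lever BY NAME; nothing restated.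

HONEST SCOPE (A6, director-ym №189).  Elementary real analysis ∕ bookkeeping over hypothesis SHAPES; §2–§3 quantify over `θ : Stage13HParams F 2` with `hP : θ.Provisos₁₃SepCoPH F 2`
— inhabited iff K0⁷ (stmt-QuantumFields-20541).  NOTHING of Bałaban is asserted or instantiated: NE4 NOT IN PRINT ([Balaban1987RG1] p. 264; GAPS G-t4-U2-1) and NOT proved; the
anchor's identification and (C) NOT proved; row (D1) NOT proved; NOT a proof of `stub_runRemNamedJets13`, `stub_d1AnchoredJets13`, `stub_rates13H` or any stub; N17 NOT discharged
(DEPENDENT∕DERIVED row); K2⁷ ∕ K3⁷ OPEN; counts UNMOVED (typed 28∕28 · discharged 5∕27 · A 5∕28).  One finite four-torus programme at fixed `ε = L^{−K}`, Bałaban AS PRINTED; the YM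
mass gap (Clay) is NOT proved by any of this — R4 closes the conditional finite-𝕋⁴ rung `BalabanLadder.UV` only; nothing continuum ∕ ℝ⁴ ∕ OS.  No `instance`, no `notation`, no
`axiom`.  [I] = [Balaban1987RG1] T. Bałaban, CMP **109** (1987): Thm 2 p. 259, (0.20) p. 256, (1.3) p. 260, (1.20)–(1.22) p. 264, Thm 3 p. 264, §1 pp. 263–264, (2.12)–(2.14) p. 268.
-/

noncomputable section

namespace Summit.QuantumFields.YangMills.BalabanUVNodes.N17RunRemAtOfShiftAnchorLevel

open Literature.MathematicalPhysics.QuantumFieldTheory.Balaban1983to89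
open Literature.MathematicalPhysics.QuantumFieldTheory.Balaban1983to89.FlowStep
open Literature.MathematicalPhysics.QuantumFieldTheory.Balaban1983to89.T4CouplingMatching (ScaleShiftRate)
open Literature.MathematicalPhysics.QuantumFieldTheory.Balaban1983to89.B12Beta (HistBox)
open Literature.MathematicalPhysics.QuantumFieldTheory.Balaban1983to89.DagBinding (EndpointExistence ForwardGenerated)
open Literature.MathematicalPhysics.QuantumFieldTheory.Balaban1983to89.T4Continuum (T4Family)
open Literature.MathematicalPhysics.QuantumFieldTheory.Balaban1983to89.Beta.Drift (OneLoopDrift)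
open Summit.QuantumFields.YangMills.Theorems.BalabanUVNodesK2JsOfRecord (StepColourData beta0OfJs stepBal_L_pos)
open Summit.QuantumFields.YangMills.Theorems.BalabanUVNodesK2NamedJetsRemAt (ConstRemainder ScaleAnchor)
open Summit.QuantumFields.YangMills.Theorems.BalabanUVNodesK2NamedJetsRunRemAt (RunRemAt RunConstRemainder SurvCont Survivors runConstRemainder_of_constRemainder
  run_of_survivor endpointExistence_of_runRemAt_drift)
open Summit.QuantumFields.BalabanUV.Gaps.EndRunwiseShooting (shoot_zero Y_eq_of_run survives_of_run)
open Summit.QuantumFields.YangMills.BalabanUVNodes.N17RunRemAtOfShiftAnchor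
open Filter Topology

/-! ## §1 Survivor continuity is ANTITONE in the level (generic `β : HBeta`) -/

section Anti

variable {β : HBeta} {γ γ' : ℝ}

/-- **A SURVIVOR OF A SMALLER LEVEL IS A SURVIVOR OF THE LARGER ONE, WITH THE SAME CLAMPED PREFIX**: for `0 < γ' ≤ γ` and `x ∈ Survivors β γ' k`, the clamped forward run of
level `γ'` from `x` is an in-window solution of (0.20) of level `γ'` (DEF-1's `run_of_survivor`), hence of level `γ`; along it BOTH clamps are inactive
(`Gaps.EndRunwiseShooting.Y_eq_of_run` ∕ `survives_of_run`), so `x ∈ Survivors β γ k` and `clampPrefix β γ' k x = clampPrefix β γ k x`. [folklore] -/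
theorem survivor_mono_level (hγ' : 0 < γ') (hle : γ' ≤ γ) {k : ℕ} {x : ℝ} (hx : x ∈ Survivors β γ' k) :
    x ∈ Survivors β γ k ∧ clampPrefix β γ' k x = clampPrefix β γ k x := by
  obtain ⟨hrg, hI'⟩ := run_of_survivor (β := β) hγ' hx
  have hI : Step.InInterval γ k (fun i => gClamp γ' (Y β γ' i x)) := fun j hj => ⟨(hI' j hj).1, (hI' j hj).2.trans hle⟩
  have h0 : gClamp γ' (Y β γ' 0 x) = x := shoot_zero hx.1 hx.2.1
  have e' : clampPrefix β γ' k (gClamp γ' (Y β γ' 0 x)) = prefixOf (fun i => gClamp γ' (Y β γ' i x)) k := (Y_eq_of_run hrg hI' k le_rfl).2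
  have e : clampPrefix β γ k (gClamp γ' (Y β γ' 0 x)) = prefixOf (fun i => gClamp γ' (Y β γ' i x)) k := (Y_eq_of_run hrg hI k le_rfl).2
  have hs : ∀ j, j ≤ k → 1 / γ ^ 2 ≤ Y β γ j (gClamp γ' (Y β γ' 0 x)) := survives_of_run hrg hI
  rw [h0] at e e' hs
  exact ⟨⟨hx.1, hx.2.1.trans hle, hs⟩, e'.trans e.symm⟩

/-- ★ **RUN-WISE (C) IS ANTITONE IN THE LEVEL**: `SurvCont β γ → SurvCont β γ'` for `0 < γ' ≤ γ` (the traces of level `γ'` are the traces of level `γ` restricted to a subset).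
So DEF-1's `RunRemAt` ∕ 2ᴮ″, which carries (C) at ONE level `γ₀ ≤ θ.γ`, supplies (C) at every smaller level — the form node N17's lever needs. [folklore] -/
theorem survCont_anti (hγ' : 0 < γ') (hle : γ' ≤ γ) (h : SurvCont β γ) : SurvCont β γ' := fun k =>
  ((h k).mono fun x hx => (survivor_mono_level hγ' hle hx).1).congr fun x hx => by
    show β k (clampPrefix β γ' k x) = β k (clampPrefix β γ k x)
    rw [(survivor_mono_level hγ' hle hx).2]

/-- A run-wise constant remainder AND survivor continuity at one level restrict TOGETHER to any smaller positive level. [folklore] -/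
theorem runLetters_mono {b : ℕ → ℝ} {r γ₀ γ₁ : ℝ} (hγ₁ : 0 < γ₁) (hle : γ₁ ≤ γ₀) (hrem : RunConstRemainder β b r γ₀) (hsc : SurvCont β γ₀) :
    RunConstRemainder β b r γ₁ ∧ SurvCont β γ₁ :=
  ⟨hrem.mono hle, survCont_anti hγ₁ hle hsc⟩

end Anti

/-! ## §2 At NODE 00's Stage-13 record (`N = 2`): the junction at ONE level of (C), and the EQUIVALENCE given node N17 -/

section Record

open YMDAG.UVSplit (U3Carriers N17At)

variable (F : T4Family) (κ : StepColourData) (θ : Node00.Stage13HParams F 2) (hP : θ.Provisos₁₃SepCoPH F 2)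

/-- ★★ **NODE N17 + THE ANCHOR + (C) AT ONE LEVEL ⟹ THE REGISTERED RUN LETTER**: as FILE 1's `runRemAt_of_n17At_scaleAnchor_survCont`, but with survivor continuity at a SINGLE
level `γ₀ > 0` — ANY level, not necessarily `≤ θ.γ` (antitonicity moves it down to `min γ_s γ₀`, where `γ_s ≤ θ.γ` is the lever's box for `s := θ.cβ · stepBal 2 F.L`).  CONDITIONAL; nothing of Bałaban asserted.
[cite: Balaban1987RG1, (1.20)-(1.22) p.264, (2.12)-(2.14) p.268 and Thm 3 p.264] -/
theorem runRemAt_of_n17At_scaleAnchor_survContAt (hθ : θ.Admissible F 2) {u : U3Carriers} (hγu : u.γ = θ.γ) (hρ0 : 0 ≤ u.ρ) (hρ1 : u.ρ < 1)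
    (h17 : N17At (Node00.datumOfRecord₁₃SepCoPH F 2 θ hP) u)
    (hA : ScaleAnchor (Node00.datumOfRecord₁₃SepCoPH F 2 θ hP).βfun (fun k => θ.cβ * beta0OfJs F κ k))
    {γ₀ : ℝ} (hγ₀ : 0 < γ₀) (hsc : SurvCont (Node00.datumOfRecord₁₃SepCoPH F 2 θ hP).βfun γ₀) :
    RunRemAt F κ θ hP θ.cβ := by
  have hγ : 0 < θ.γ := hθ.toStage12.toStage9.gamma_pos
  have hS := cβ_mul_stepBal_pos F θ hθ
  obtain ⟨γs, hγs, hγsγ, hrem⟩ :=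
    exists_constRemainder_of_scaleShiftRate_scaleAnchor hγ hρ0 hρ1 hA (scaleShiftRate_of_n17At_window F θ hP hγu h17) hS
  refine ⟨min γs γ₀, θ.cβ * B12Normalization.stepBal 2 F.L, lt_min hγs hγ₀, (min_le_left _ _).trans hγsγ, le_rfl, ?_, hA,
    survCont_anti (lt_min hγs hγ₀) (min_le_right _ _) hsc⟩
  exact runConstRemainder_of_constRemainder (hrem.mono (min_le_left _ _))

/-- ★★★ **GIVEN NODE N17, THE REGISTERED LETTER `RunRemAt F κ θ hP θ.cβ` IS EXACTLY «κ ANCHORS ∧ (C) AT SOME POSITIVE LEVEL»** — its quantitative (D4)∧B4 conjunct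
(`RunConstRemainder` with the cap `s ≤ θ.cβ·stepBal 2 F.L`) and its window clause `γ₀ ≤ θ.γ` carry NO content beyond N17 + the two qualitative conjuncts.  (→: projection;
←: the junction.)  CONDITIONAL on N17.
[cite: Balaban1987RG1, (1.20)-(1.22) p.264, (2.12)-(2.14) p.268 and Thm 3 p.264] -/
theorem runRemAt_iff_anchor_survCont_of_n17At (hθ : θ.Admissible F 2) {u : U3Carriers} (hγu : u.γ = θ.γ) (hρ0 : 0 ≤ u.ρ) (hρ1 : u.ρ < 1)
    (h17 : N17At (Node00.datumOfRecord₁₃SepCoPH F 2 θ hP) u) :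
    RunRemAt F κ θ hP θ.cβ ↔
      ScaleAnchor (Node00.datumOfRecord₁₃SepCoPH F 2 θ hP).βfun (fun k => θ.cβ * beta0OfJs F κ k) ∧
        ∃ γ₀ : ℝ, 0 < γ₀ ∧ SurvCont (Node00.datumOfRecord₁₃SepCoPH F 2 θ hP).βfun γ₀ := by
  constructor
  · rintro ⟨γ₀, s, hγ₀, -, -, -, hA, hsc⟩
    exact ⟨hA, γ₀, hγ₀, hsc⟩
  · rintro ⟨hA, γ₀, hγ₀, hsc⟩
    exact runRemAt_of_n17At_scaleAnchor_survContAt F κ θ hP hθ hγu hρ0 hρ1 h17 hA hγ₀ hsc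

end Record

/-! ## §3 Text level (K2⁷ v6's full prefix; `Window13` spelled as the crux decl spells it) -/

section Texts

open YMDAG.UVSplit (U3Carriers N17At)

/-- ★★★ **GIVEN THE `N17AtRecord13` TEXT, THE REGISTERED 2ᴮ″ TEXT `RunRemAtSomeJets` IS EQUIVALENT TO THE TEXT «∃ κ, ScaleAnchor (datum).βfun (θ.cβ•beta0OfJs F κ) ∧ ∃ γ₀ > 0,
SurvCont (datum).βfun γ₀»** (both under K2⁷ v6's full prefix).  Modulo node N17 (END-free), K2⁷'s XL stub 2ᴮ″ is therefore EXACTLY the anchor (identification) + survivor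
continuity at one positive level.  CONDITIONAL; NOT a proof of `stub_runRemNamedJets13`. [cite: Balaban1987RG1, (1.20)-(1.22) p.264, (2.12)-(2.14) p.268 and Thm 3 p.264] -/
theorem runRemAtSomeJets_iff_anchorSurvAtSomeJets_of_n17AtRecord13
    (hN : ∀ (F : T4Family) (θ : Node00.Stage13HParams F 2) (hP : θ.Provisos₁₃SepCoPH F 2), (θ.ZhUnity F 2 ∧ θ.SlotsNondegenerate₁₃ F 2) → θ.Admissible F 2 →
      B16.EndStatementBPrinted (Node00.datumOfRecord₁₃SepCoPH F 2 θ hP).C →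
      (∃ γ₁ : ℝ, 0 < γ₁ ∧ ∀ γ : ℝ, 0 < γ → γ ≤ γ₁ → ∃ P : B12.RunParams, 1 ≤ P.K ∧ ((Node00.datumOfRecord₁₃SepCoPH F 2 θ hP).C P).flow.InInterval γ P.K) →
      ∃ u : U3Carriers, u.γ = θ.γ ∧ 0 ≤ u.ρ ∧ u.ρ < 1 ∧ N17At (Node00.datumOfRecord₁₃SepCoPH F 2 θ hP) u) :
    (∀ (F : T4Family) (θ : Node00.Stage13HParams F 2) (hP : θ.Provisos₁₃SepCoPH F 2), (θ.ZhUnity F 2 ∧ θ.SlotsNondegenerate₁₃ F 2) → θ.Admissible F 2 →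
      B16.EndStatementBPrinted (Node00.datumOfRecord₁₃SepCoPH F 2 θ hP).C →
      (∃ γ₁ : ℝ, 0 < γ₁ ∧ ∀ γ : ℝ, 0 < γ → γ ≤ γ₁ → ∃ P : B12.RunParams, 1 ≤ P.K ∧ ((Node00.datumOfRecord₁₃SepCoPH F 2 θ hP).C P).flow.InInterval γ P.K) →
      ∃ κ : StepColourData, RunRemAt F κ θ hP θ.cβ) ↔
    (∀ (F : T4Family) (θ : Node00.Stage13HParams F 2) (hP : θ.Provisos₁₃SepCoPH F 2), (θ.ZhUnity F 2 ∧ θ.SlotsNondegenerate₁₃ F 2) → θ.Admissible F 2 →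
      B16.EndStatementBPrinted (Node00.datumOfRecord₁₃SepCoPH F 2 θ hP).C →
      (∃ γ₁ : ℝ, 0 < γ₁ ∧ ∀ γ : ℝ, 0 < γ → γ ≤ γ₁ → ∃ P : B12.RunParams, 1 ≤ P.K ∧ ((Node00.datumOfRecord₁₃SepCoPH F 2 θ hP).C P).flow.InInterval γ P.K) →
      ∃ κ : StepColourData, ScaleAnchor (Node00.datumOfRecord₁₃SepCoPH F 2 θ hP).βfun (fun k => θ.cβ * beta0OfJs F κ k) ∧
        ∃ γ₀ : ℝ, 0 < γ₀ ∧ SurvCont (Node00.datumOfRecord₁₃SepCoPH F 2 θ hP).βfun γ₀) := by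
  constructor
  · intro h F θ hP hU hθ hB hwin
    obtain ⟨u, hγu, hρ0, hρ1, h17⟩ := hN F θ hP hU hθ hB hwin
    obtain ⟨κ, hRun⟩ := h F θ hP hU hθ hB hwin
    exact ⟨κ, (runRemAt_iff_anchor_survCont_of_n17At F κ θ hP hθ hγu hρ0 hρ1 h17).1 hRun⟩
  · intro h F θ hP hU hθ hB hwin
    obtain ⟨u, hγu, hρ0, hρ1, h17⟩ := hN F θ hP hU hθ hB hwin
    obtain ⟨κ, hAS⟩ := h F θ hP hU hθ hB hwin
    exact ⟨κ, (runRemAt_iff_anchor_survCont_of_n17At F κ θ hP hθ hγu hρ0 hρ1 h17).2 hAS⟩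

/-- ★★★ **THE CRUX DECL BY NAME FROM {1ᴬ's TEXT, `N17AtRecord13`'s TEXT, «∃ κ, anchor ∧ ONE-LEVEL (C)»}** (FILE 1's `EndpointGivenBR13SepCoPH_of_d1Anchored_n17_anchorSurv` with the
(C) text weakened to one level).  CONDITIONAL on the three displayed hypothesis texts; K2⁷ NOT closed; nothing of Bałaban asserted.
[cite: Balaban1987RG1, Thm 2 p.259 (first sentence), (1.3) p.260, (1.20)-(1.22) p.264 and (2.12)-(2.14) p.268] -/
theorem EndpointGivenBR13SepCoPH_of_d1Anchored_n17_anchorSurvAt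
    (h₁ : ∀ (F : T4Family) (κ : StepColourData) (θ : Node00.Stage13HParams F 2) (hP : θ.Provisos₁₃SepCoPH F 2), (θ.ZhUnity F 2 ∧ θ.SlotsNondegenerate₁₃ F 2) →
      θ.Admissible F 2 → B16.EndStatementBPrinted (Node00.datumOfRecord₁₃SepCoPH F 2 θ hP).C →
      (∃ γ₁ : ℝ, 0 < γ₁ ∧ ∀ γ : ℝ, 0 < γ → γ ≤ γ₁ → ∃ P : B12.RunParams, 1 ≤ P.K ∧ ((Node00.datumOfRecord₁₃SepCoPH F 2 θ hP).C P).flow.InInterval γ P.K) →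
      ScaleAnchor (Node00.datumOfRecord₁₃SepCoPH F 2 θ hP).βfun (fun k => θ.cβ * beta0OfJs F κ k) →
      ∃ A : ℝ, OneLoopDrift (B12Normalization.stepBal 2 F.L) A (beta0OfJs F κ))
    (hN : ∀ (F : T4Family) (θ : Node00.Stage13HParams F 2) (hP : θ.Provisos₁₃SepCoPH F 2), (θ.ZhUnity F 2 ∧ θ.SlotsNondegenerate₁₃ F 2) → θ.Admissible F 2 →
      B16.EndStatementBPrinted (Node00.datumOfRecord₁₃SepCoPH F 2 θ hP).C →
      (∃ γ₁ : ℝ, 0 < γ₁ ∧ ∀ γ : ℝ, 0 < γ → γ ≤ γ₁ → ∃ P : B12.RunParams, 1 ≤ P.K ∧ ((Node00.datumOfRecord₁₃SepCoPH F 2 θ hP).C P).flow.InInterval γ P.K) →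
      ∃ u : U3Carriers, u.γ = θ.γ ∧ 0 ≤ u.ρ ∧ u.ρ < 1 ∧ N17At (Node00.datumOfRecord₁₃SepCoPH F 2 θ hP) u)
    (hAS : ∀ (F : T4Family) (θ : Node00.Stage13HParams F 2) (hP : θ.Provisos₁₃SepCoPH F 2), (θ.ZhUnity F 2 ∧ θ.SlotsNondegenerate₁₃ F 2) → θ.Admissible F 2 →
      B16.EndStatementBPrinted (Node00.datumOfRecord₁₃SepCoPH F 2 θ hP).C →
      (∃ γ₁ : ℝ, 0 < γ₁ ∧ ∀ γ : ℝ, 0 < γ → γ ≤ γ₁ → ∃ P : B12.RunParams, 1 ≤ P.K ∧ ((Node00.datumOfRecord₁₃SepCoPH F 2 θ hP).C P).flow.InInterval γ P.K) →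
      ∃ κ : StepColourData, ScaleAnchor (Node00.datumOfRecord₁₃SepCoPH F 2 θ hP).βfun (fun k => θ.cβ * beta0OfJs F κ k) ∧
        ∃ γ₀ : ℝ, 0 < γ₀ ∧ SurvCont (Node00.datumOfRecord₁₃SepCoPH F 2 θ hP).βfun γ₀) :
    Summit.QuantumFields.YangMills.Theses.BalabanUVNodes.EndpointGivenBR13SepCoPH := by
  intro F θ hP hU hθ hB hwin
  obtain ⟨u, hγu, hρ0, hρ1, h17⟩ := hN F θ hP hU hθ hB hwin
  obtain ⟨κ, hA, γ₀, hγ₀, hsc⟩ := hAS F θ hP hU hθ hB hwin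
  have hRun : RunRemAt F κ θ hP θ.cβ := runRemAt_of_n17At_scaleAnchor_survContAt F κ θ hP hθ hγu hρ0 hρ1 h17 hA hγ₀ hsc
  obtain ⟨A, hdrift⟩ := h₁ F κ θ hP hU hθ hB hwin hA
  exact endpointExistence_of_runRemAt_drift F κ θ hP hRun hdrift

end Texts


end Summit.QuantumFields.YangMills.BalabanUVNodes.N17RunRemAtOfShiftAnchorLevel

end
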